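import Mathlib
import Summits.Ventures.PercRepro.TriangleCapDiagonalCapGen

/-!
# PercRepro — THE DIAGONAL `r = 0` OF EVERY ROW `a ≥ 3` AT SECOND ORDER: a `K₄⁻`-free graph with `a (k − a)`
edges on `k ≥ 2a + 1` vertices is a spanning subgraph of some `K(A, Aᶜ)`, `|A| = a` — i.e. it is `K_{a,k−a}` —
or at least `2a (k − 2a − 1)` below `m k`; the other bipartition `K_{a+1,k−a−1}` minus a `(k − 2a − 1)`-star is
sharp, so THE SECOND-BEST VALUE OF THE CHERRY TABLE ON EVERY DIAGONAL CELL IS KNOWN (p3, gen 44; part 195b)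

The row `a = 3` is part 194 (`diag_second_order`, `6 (k − 7)`); here every row `a ≥ 4` uniformly, by the pieces of
part 195a and an induction on `k` (every vertex type): `k = 2a + 1` is the envelope; a vertex at the cap `k − a`
makes `D` `a`-bipartite (`diag_cap_gen`); every degree in `[a + 1, k − a − 1]` gives `k (k − 2a − 1)` by the
convexity of the row `a + 1` (`diag_convex_gen`); a vertex of degree `≤ a − 1` is the cross-row deletion
(`diag_cross_gen`); a vertex `z` of degree `a` is deleted onto the diagonal at `k − 1`: `D − z` is `a`-bipartite —
then it is `K_{a,k−1−a}`, the `a ≥ 3` neighbours of `z` lie on one side by `K₄⁻`-freeness (two on one side and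
one on the other make two triangles on an edge at `z`), on the small side `D` is `a`-bipartite and on the large
side `D` is `K_{a+1,k−a−1}` minus a star, exactly `2a (k − 2a − 1)` below — or `D − z` is `2a (k − 2a − 2)` below
its `m' (k − 1)` and the neighbours of `z` at `≤ k − a − 2` close the count exactly. The gap `B2 = 2 (k − 2a − 1)
(a − r)` of §10bt(c) at `r = 0` is attained by `other_bipartition_value`. `diag_second_best_all (3 ≤ a)
(2a + 2 ≤ k)`: the second-best value of `Σ_v d(v)²` over the non-extremal `K₄⁻`-free graphs on `Fin k` with
`a (k − a)` edges is exactly `m k − 2a (k − 2a − 1)`. Axioms: standard.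
-/

namespace PercRepro

namespace TriangleCap

namespace C047

open Finset

universe u

variable {V : Type*} [Fintype V] [DecidableEq V]

/-- **THE DIAGONAL OF THE ROW `a ≥ 4` AT SECOND ORDER, EVERY VERTEX TYPE, BY INDUCTION ON `k`:** `K₄⁻`-free,
`m = a (k − a)`, `2a + 1 ≤ k` ⇒ `a`-bipartite or `Σ_v d(v)² + 2a (k − 2a − 1) ≤ m k`. -/
theorem diag_second_order_gen_aux (a : ℕ) (ha : 4 ≤ a) (n : ℕ) :
    ∀ (W : Type u) [Fintype W] [DecidableEq W] (D : SimpleGraph W) [DecidableRel D.Adj], Fintype.card W = n →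
      K4mFree D → 2 * a + 1 ≤ Fintype.card W → D.edgeFinset.card = a * (Fintype.card W - a) →
      (∃ A : Finset W, A.card = a ∧ BipSub D A) ∨
        ∑ v, deg D v * deg D v + 2 * a * (Fintype.card W - 2 * a - 1) ≤
          D.edgeFinset.card * Fintype.card W := by
  refine Nat.strong_induction_on n ?_
  intro n ih W _ _ D _ hn hK hk hm
  -- `k = 2a + 1`: the envelope
  rcases Nat.lt_or_ge (Fintype.card W) (2 * a + 2) with hk1 | hk2
  · right
    have h := sum_deg_sq_le_of_k4mFree D hK (by omega)
    have e : Fintype.card W - 2 * a - 1 = 0 := by omega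
    rw [e, mul_zero, add_zero]
    exact h
  -- (A) a vertex at the cap `k − a` makes `D` `a`-bipartite
  by_cases hx : ∃ x, deg D x + a = Fintype.card W
  · obtain ⟨x, hx⟩ := hx
    exact Or.inl (diag_cap_gen D hK a ha (by omega) hm x hx)
  push Not at hx
  have hcap : ∀ v, deg D v + a ≤ Fintype.card W := fun v =>
    deg_add_le_card_of_dense D hK a (by omega) (by omega)
      (cap_arith a (Fintype.card W) D.edgeFinset.card 0 (by omega) (by omega)
        (diag_cap_arith a (Fintype.card W) D.edgeFinset.card (by omega) hm)) v
  have hcap' : ∀ v, deg D v + a + 1 ≤ Fintype.card W := fun v => by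
    have h1 := hcap v
    have h2 := hx v
    omega
  -- (B) every degree `≥ a + 1`: the convexity of the row `a + 1`
  by_cases hdeg : ∀ v, a + 1 ≤ deg D v
  · right
    have h := diag_convex_gen D a hk hm hcap' hdeg
    have h2 : 2 * a * (Fintype.card W - 2 * a - 1) ≤ Fintype.card W * (Fintype.card W - 2 * a - 1) :=
      Nat.mul_le_mul_right _ (by omega)
    omega
  push Not at hdeg
  obtain ⟨z, hz⟩ := hdeg
  -- (C) a vertex of degree `≤ a − 1`: the cross-row deletion
  rcases Nat.lt_or_ge (deg D z) a with hz1 | hz2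
  · exact Or.inr (diag_cross_gen D hK a (by omega) hk2 hm hcap' z (by omega))
  -- (D) a vertex `z` of degree `a`: deleted onto the diagonal at `k − 1`
  have hza : deg D z = a := by omega
  have hK' := k4mFree_del D hK z
  have hcard' := card_del z
  have hedges' := card_edges_del D z
  have hsq := sum_deg_sq_del D z
  rw [hza] at hedges' hsq
  obtain ⟨c, hc⟩ : ∃ c, Fintype.card W = 2 * a + 2 + c := ⟨Fintype.card W - (2 * a + 2), by omega⟩
  have hcardW' : Fintype.card {v : W // v ≠ z} = 2 * a + 1 + c := by omega
  have hT := sum_del_nbhd_le D z (Fintype.card W - a - 2) (fun v => by have := hcap' v; omega)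
  rw [hza] at hT
  obtain ⟨T, hTdef⟩ : ∃ T, ∑ w : {v : W // v ≠ z}, (if D.Adj w.1 z then deg (del D z) w else 0) = T := ⟨_, rfl⟩
  obtain ⟨S', hS'def⟩ : ∃ S', ∑ w : {v : W // v ≠ z}, deg (del D z) w * deg (del D z) w = S' := ⟨_, rfl⟩
  obtain ⟨m', hm'def⟩ : ∃ m', (del D z).edgeFinset.card = m' := ⟨_, rfl⟩
  rw [hTdef, hS'def] at hsq
  rw [hTdef] at hT
  rw [hm'def] at hedges'
  have hm'' : m' = a * (a + 1 + c) := by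
    have e2 : Fintype.card W - a = a + 2 + c := by omega
    rw [e2] at hm
    nlinarith [hedges', hm]
  have hm' : (del D z).edgeFinset.card = a * (Fintype.card {v : W // v ≠ z} - a) := by
    rw [hm'def, hcardW', hm'']
    congr 1
    omega
  rcases ih (Fintype.card {v : W // v ≠ z}) (by omega) {v : W // v ≠ z} (del D z) rfl hK' (by omega) hm'
    with ⟨A', hA'card, hA'⟩ | hgap
  · -- `D − z` is `K_{a,k−1−a}`: the `a` neighbours of `z` are on one side
    have hfull : ∀ {x y : {v : W // v ≠ z}}, x ∈ A' → y ∉ A' → (del D z).Adj x y := fun hx hy =>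
      adj_of_bipSub_full (del D z) A' hA' a hA'card hm' hx hy
    by_cases hall : ∀ w : {v : W // v ≠ z}, D.Adj w.1 z → w ∈ A'
    · obtain ⟨B, hBcard, hB⟩ := bipSub_lift D z A' hA' hall
      exact Or.inl ⟨B, by rw [hBcard, hA'card], hB⟩
    · push Not at hall
      obtain ⟨a₀, ha₀z, ha₀A⟩ := hall
      right
      -- every neighbour of `z` is off `A'`
      have hoff : ∀ w : {v : W // v ≠ z}, D.Adj w.1 z → w ∉ A' := by
        intro a₁ ha₁z ha₁A
        -- a third neighbour `a₂` (`a ≥ 3`)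
        have hne01 : a₀ ≠ a₁ := fun h => ha₀A (h ▸ ha₁A)
        obtain ⟨a₂, ha₂z, ha₂0, ha₂1⟩ : ∃ a₂ : {v : W // v ≠ z}, D.Adj a₂.1 z ∧ a₂ ≠ a₀ ∧ a₂ ≠ a₁ := by
          have hcarda : (univ.filter (fun w : {v : W // v ≠ z} => D.Adj w.1 z)).card = a := by
            have h := sum_del_nbhd_const D z 1
            rw [hza, mul_one, ← card_filter] at h
            exact h
          have h2 : 2 < (univ.filter (fun w : {v : W // v ≠ z} => D.Adj w.1 z)).card := by omega
          obtain ⟨b₁, hb₁, b₂, hb₂, b₃, hb₃, h12, h13, h23⟩ := two_lt_card.mp h2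
          rw [mem_filter] at hb₁ hb₂ hb₃
          by_cases e1 : b₁ = a₀ ∨ b₁ = a₁
          · by_cases e2 : b₂ = a₀ ∨ b₂ = a₁
            · refine ⟨b₃, hb₃.2, ?_, ?_⟩
              · intro h; rcases e1 with rfl | rfl <;> rcases e2 with rfl | rfl <;>
                  first | exact h12 rfl | exact h13 h | exact h13 h.symm | exact h23 h | exact h23 h.symm
              · intro h; rcases e1 with rfl | rfl <;> rcases e2 with rfl | rfl <;>
                  first | exact h12 rfl | exact h13 h | exact h13 h.symm | exact h23 h | exact h23 h.symm
            · push Not at e2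
              exact ⟨b₂, hb₂.2, e2.1, e2.2⟩
          · push Not at e1
            exact ⟨b₁, hb₁.2, e1.1, e1.2⟩
        -- `a₁ ∈ A'`, `a₀ ∉ A'`, so `a₁ ∼ a₀` in `D`
        have h10 : D.Adj a₁.1 a₀.1 := (del_adj D z a₁ a₀).mp (hfull ha₁A ha₀A)
        by_cases ha₂A : a₂ ∈ A'
        · have h20 : D.Adj a₂.1 a₀.1 := (del_adj D z a₂ a₀).mp (hfull ha₂A ha₀A)
          -- the triangles `z a₁ a₀` and `z a₂ a₀` share `z a₀`
          exact not_adj_both D hK (D.adj_symm ha₀z) (D.adj_symm ha₁z) (D.adj_symm h10)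
            (fun h => ha₂1 (Subtype.ext h).symm) (D.adj_symm ha₂z) (D.adj_symm h20)
        · have h12' : D.Adj a₁.1 a₂.1 := (del_adj D z a₁ a₂).mp (hfull ha₁A ha₂A)
          -- the triangles `z a₁ a₀` and `z a₁ a₂` share `z a₁`
          exact not_adj_both D hK (D.adj_symm ha₁z) (D.adj_symm ha₀z) h10
            (fun h => ha₂0 (Subtype.ext h).symm) (D.adj_symm ha₂z) h12'
      -- the neighbours of `z` have degree `≤ a` in `D − z`
      have hTa : T ≤ a * a := by
        rw [← hTdef]
        have h1 : ∑ w : {v : W // v ≠ z}, (if D.Adj w.1 z then deg (del D z) w else 0) ≤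
            ∑ w : {v : W // v ≠ z}, (if D.Adj w.1 z then a else 0) := by
          apply sum_le_sum
          intro w _
          by_cases h : D.Adj w.1 z
          · simp only [h, if_true]
            have := deg_le_card_of_bipSub (del D z) A' hA' w (hoff w h)
            rw [hA'card] at this
            exact this
          · simp [h]
        have h2 := sum_del_nbhd_const D z a
        rw [hza] at h2
        omega
      have henv := sum_deg_sq_le_of_k4mFree (del D z) hK' (by omega)
      rw [hS'def, hm'def, hcardW'] at henv
      rw [hsq, ← hedges', hc]
      have e1 : 2 * a + 2 + c - 2 * a - 1 = c + 1 := by omega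
      rw [e1]
      exact diag_within_arith_bip a c m' S' T hm'' henv hTa
  · -- `D − z` is `2a (k − 2a − 2)` below: the neighbours of `z` at `≤ k − a − 2` close the count
    right
    rw [hS'def, hm'def, hcardW'] at hgap
    have e0 : 2 * a + 1 + c - 2 * a - 1 = c := by omega
    rw [e0] at hgap
    rw [hc] at hT
    have e1 : 2 * a + 2 + c - a - 2 = a + c := by omega
    rw [e1] at hT
    rw [hsq, ← hedges', hc]
    have e2 : 2 * a + 2 + c - 2 * a - 1 = c + 1 := by omega
    rw [e2]
    exact diag_within_arith_gap a c m' S' T hm'' hgap hT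

/-- **THE DIAGONAL OF THE ROW `a ≥ 4` AT SECOND ORDER:** `K₄⁻`-free, `m = a (k − a)`, `2a + 1 ≤ k` ⇒ `D` is a
spanning subgraph of some `K(A, Aᶜ)` with `|A| = a` (then `D = K_{a,k−a}`), or `Σ_v d(v)² + 2a (k − 2a − 1) ≤ m k`. -/
theorem diag_second_order_gen (D : SimpleGraph V) [DecidableRel D.Adj] (hK : K4mFree D) (a : ℕ) (ha : 4 ≤ a)
    (hk : 2 * a + 1 ≤ Fintype.card V) (hm : D.edgeFinset.card = a * (Fintype.card V - a)) :
    (∃ A : Finset V, A.card = a ∧ BipSub D A) ∨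
      ∑ v, deg D v * deg D v + 2 * a * (Fintype.card V - 2 * a - 1) ≤ D.edgeFinset.card * Fintype.card V :=
  diag_second_order_gen_aux a ha (Fintype.card V) V D rfl hK hk hm

/-- **THE DIAGONAL OF EVERY ROW `a ≥ 3` AT SECOND ORDER** (the row `a = 3` by part 194, `6 (k − 7) = 2·3·(k − 7)`):
`K₄⁻`-free, `m = a (k − a)`, `2a + 1 ≤ k` ⇒ `a`-bipartite or `Σ_v d(v)² + 2a (k − 2a − 1) ≤ m k`. -/
theorem diag_second_order_all (D : SimpleGraph V) [DecidableRel D.Adj] (hK : K4mFree D) (a : ℕ) (ha : 3 ≤ a)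
    (hk : 2 * a + 1 ≤ Fintype.card V) (hm : D.edgeFinset.card = a * (Fintype.card V - a)) :
    (∃ A : Finset V, A.card = a ∧ BipSub D A) ∨
      ∑ v, deg D v * deg D v + 2 * a * (Fintype.card V - 2 * a - 1) ≤ D.edgeFinset.card * Fintype.card V := by
  rcases Nat.lt_or_ge a 4 with h3 | h4
  · obtain rfl : a = 3 := by omega
    rcases diag_second_order D hK (by omega) (by omega) with h | h
    · exact Or.inl h
    · right
      have e : 2 * 3 * (Fintype.card V - 2 * 3 - 1) = 6 * (Fintype.card V - 7) := by omega
      rw [e]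
      exact h
  · exact diag_second_order_gen D hK a h4 hk hm

/-- An `a`-bipartite `K₄⁻`-free graph with `a (k − a)` edges is `K_{a,k−a}` and attains `Σ_v d(v)² = m k`. -/
theorem sum_deg_sq_eq_of_bipSub_full (D : SimpleGraph V) [DecidableRel D.Adj] (A : Finset V) (a : ℕ)
    (hA : A.card = a) (hB : BipSub D A) (hm : D.edgeFinset.card = a * (Fintype.card V - a)) (hne : Nonempty V) :
    ∑ v, deg D v * deg D v = D.edgeFinset.card * Fintype.card V := by
  obtain ⟨v⟩ := hne
  have hstar : MissingStar D A v := fun x y hx hy hxy =>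
    absurd (adj_of_bipSub_full D A hB a hA hm hx hy) hxy
  have h := closed_form_eq_of_missingStar D A hB hstar a 0 hA (by rw [add_zero]; exact hm)
    (Fintype.card_pos_iff.mpr ⟨v⟩)
  simpa using h

/-- **THE SECOND-BEST VALUE ON THE DIAGONAL OF EVERY ROW `a ≥ 3`:** for `2a + 2 ≤ k`, every non-extremal
`K₄⁻`-free graph on `Fin k` with `a (k − a)` edges has `Σ_v d(v)² + 2a (k − 2a − 1) ≤ m k`, and the value is
attained (`K_{a+1,k−a−1}` minus a `(k − 2a − 1)`-star, the family `B2` of §10bt(c) at `r = 0`). -/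
theorem diag_second_best_all (k a : ℕ) (ha : 3 ≤ a) (hk : 2 * a + 2 ≤ k) :
    (∀ (D : SimpleGraph (Fin k)) [DecidableRel D.Adj], K4mFree D → D.edgeFinset.card = a * (k - a) →
        ∑ v, deg D v * deg D v ≠ D.edgeFinset.card * k →
        ∑ v, deg D v * deg D v + 2 * a * (k - 2 * a - 1) ≤ D.edgeFinset.card * k) ∧
      ∃ (D : SimpleGraph (Fin k)) (_ : DecidableRel D.Adj), K4mFree D ∧ D.edgeFinset.card = a * (k - a) ∧
        ∑ v, deg D v * deg D v + 2 * a * (k - 2 * a - 1) = D.edgeFinset.card * k := by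
  have hcard : Fintype.card (Fin k) = k := Fintype.card_fin k
  refine ⟨?_, ?_⟩
  · intro D _ hK hm hne
    rcases diag_second_order_all D hK a ha (by omega) (by rw [hcard]; exact hm) with ⟨A, hAcard, hA⟩ | h
    · exfalso
      apply hne
      have := sum_deg_sq_eq_of_bipSub_full D A a hAcard hA (by rw [hcard]; exact hm)
        (Fintype.card_pos_iff.mp (by omega))
      rw [hcard] at this
      exact this
    · rw [hcard] at h
      exact h
  · obtain ⟨D, inst, hK, hE, hS⟩ := other_bipartition_value k a 0 (by omega) (by omega) hk
    have hE' : D.edgeFinset.card = a * (k - a) := by simpa using hE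
    refine ⟨D, inst, hK, hE', ?_⟩
    rw [hE']
    simp only [Nat.sub_zero, zero_mul, add_zero] at hS
    rw [mul_right_comm 2 a (k - 2 * a - 1)]
    exact hS

end C047

end TriangleCap

end PercRepro
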